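import Literature.AlgebraicTopology.Homotopy.CompactlySupportedSpheres
import HarnessLib

/-!
# Cutting a compactly supported sphere along hyperplanes: slab additivity in `πₖ(X, x₀)`

Topic `Literature/AlgebraicTopology/Homotopy`, continuing `CompactlySupportedSpheres.lean`. The
group law of `π_ k X x₀` is concatenation along a coordinate (`GenLoop.transAt`,
`HomotopyGroup.mul_spec`). For compactly supported spheres `φ : ℝᵏ → X` this becomes:

* `CSphere.piece φ K …`: the sphere equal to `φ` on the closed set `K` and to `x₀` elsewhere
  (`φ = x₀` on the frontier of `K`);
* `CSphere.toClass_eq_mul_of_wall`: **if `φ = x₀` on the hyperplane `{y₀ = a}`, then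
  `[φ] = [φ·𝟙_{y₀ ≥ a}] · [φ·𝟙_{y₀ ≤ a}]`** — the concatenation of the two pieces is a
  reparametrisation of `φ` in the coordinate `0`, hence homotopic to it rel `∂Iᵏ`;
* `CSphere.toClass_eq_prod_piece`: if `φ = x₀` off finitely many disjoint open slabs
  `{aᵢ < y₀ < bᵢ}` (`bᵢ < aᵢ₊₁`), then `[φ]` is the product of the classes of its pieces on
  the closed slabs (`k ≥ 2`, where `πₖ` is abelian).

Hatcher, *Algebraic Topology* (2002), §4.1, p. 340 (the sum `f + g` in `πₙ` and its
well-known independence of where the cube is cut). Everything is proved; `[folklore]`.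

## References

* A. Hatcher, *Algebraic Topology*, CUP (2002), §4.1, p. 340. [HatcherAT2002]
-/

noncomputable section

open Set Metric unitInterval Topology
open scoped Topology.Homotopy

universe u

namespace Literature.AlgebraicTopology.Homotopy

namespace CSphere

variable {k : ℕ} {X : Type u} [TopologicalSpace X] {x₀ : X}

/-! ### Pieces of a sphere -/

/-- **The piece** of a compactly supported sphere on a closed set `K` on whose frontier it is
`x₀`: `φ` on `K`, `x₀` elsewhere. [folklore] -/
def piece (φ : CSphere k X x₀) (K : Set (Fin k → ℝ)) (hK : ∀ y ∈ frontier K, φ y = x₀) :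
    CSphere k X x₀ := by
  classical
  exact ⟨fun y => if y ∈ K then φ y else x₀,
    Continuous.if (fun z hz => hK z (by simpa using hz)) φ.continuous continuous_const, by
      obtain ⟨R, hR⟩ := φ.exists_bound
      exact ⟨R, fun y hy => by split_ifs; exacts [hR y hy, rfl]⟩⟩

/-- Unfolding `piece`. [folklore] -/
theorem piece_apply (φ : CSphere k X x₀) (K : Set (Fin k → ℝ)) (hK) (y : Fin k → ℝ)
    [Decidable (y ∈ K)] : piece φ K hK y = if y ∈ K then φ y else x₀ := by
  unfold piece
  by_cases h : y ∈ K <;> simp [h]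

/-- On `K` the piece is `φ`. [folklore] -/
theorem piece_apply_of_mem (φ : CSphere k X x₀) {K : Set (Fin k → ℝ)} (hK) {y : Fin k → ℝ}
    (hy : y ∈ K) : piece φ K hK y = φ y := by
  classical rw [piece_apply, if_pos hy]

/-- Off `K` the piece is `x₀`. [folklore] -/
theorem piece_apply_of_not_mem (φ : CSphere k X x₀) {K : Set (Fin k → ℝ)} (hK) {y : Fin k → ℝ}
    (hy : y ∉ K) : piece φ K hK y = x₀ := by
  classical rw [piece_apply, if_neg hy]

/-- `toClass_eq` with the class read in `π_ k X x₀` (for rewriting under the group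
operations). [folklore] -/
theorem toClass_eq' (φ : CSphere k X x₀) {R : ℝ} (hR : 0 ≤ R) (h : ∀ y, R ≤ ‖y‖ → φ y = x₀) :
    φ.toClass = (⟦toGenLoop φ R hR h⟧ : π_ k X x₀) :=
  toClass_eq φ hR h

/-! ### Cutting along a hyperplane `{y₀ = a}` -/

section Wall

variable [NeZero k]

/-- The frontier of the closed half-space `{y₀ ≤ a}` lies in the hyperplane `{y₀ = a}`.
[folklore] -/
theorem frontier_setOf_apply_le_subset (a : ℝ) :
    frontier {y : Fin k → ℝ | y 0 ≤ a} ⊆ {y | y 0 = a} :=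
  (frontier_le_subset_eq (continuous_apply 0) continuous_const)

/-- The frontier of the closed half-space `{a ≤ y₀}` lies in the hyperplane `{y₀ = a}`.
[folklore] -/
theorem frontier_setOf_le_apply_subset (a : ℝ) :
    frontier {y : Fin k → ℝ | a ≤ y 0} ⊆ {y | y 0 = a} := fun _ hy =>
  ((frontier_le_subset_eq continuous_const (continuous_apply 0)) hy).symm

/-- The lower piece `φ·𝟙_{y₀ ≤ a}` of a sphere vanishing on the wall `{y₀ = a}`. [folklore] -/
def lowerPiece (φ : CSphere k X x₀) (a : ℝ) (hwall : ∀ y : Fin k → ℝ, y 0 = a → φ y = x₀) :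
    CSphere k X x₀ :=
  piece φ {y | y 0 ≤ a} fun y hy => hwall y (frontier_setOf_apply_le_subset a hy)

/-- The upper piece `φ·𝟙_{a ≤ y₀}` of a sphere vanishing on the wall `{y₀ = a}`. [folklore] -/
def upperPiece (φ : CSphere k X x₀) (a : ℝ) (hwall : ∀ y : Fin k → ℝ, y 0 = a → φ y = x₀) :
    CSphere k X x₀ :=
  piece φ {y | a ≤ y 0} fun y hy => hwall y (frontier_setOf_le_apply_subset a hy)

/-- The lower piece, evaluated. [folklore] -/
theorem lowerPiece_apply (φ : CSphere k X x₀) (a : ℝ) (hwall) (y : Fin k → ℝ) :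
    lowerPiece φ a hwall y = if y 0 ≤ a then φ y else x₀ := by
  classical exact piece_apply φ _ _ y

/-- The upper piece, evaluated. [folklore] -/
theorem upperPiece_apply (φ : CSphere k X x₀) (a : ℝ) (hwall) (y : Fin k → ℝ) :
    upperPiece φ a hwall y = if a ≤ y 0 then φ y else x₀ := by
  classical exact piece_apply φ _ _ y

/-- The reparametrisation of `[0, 1]` realising "lower piece at double speed, pause at the wall,
upper piece at double speed": `ψ x = min (2x) (max c (2x - 1))`. [folklore] -/
def wallReparam (c x : ℝ) : ℝ := min (2 * x) (max c (2 * x - 1))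

/-- `wallReparam c` is continuous. [folklore] -/
theorem continuous_wallReparam (c : ℝ) : Continuous (wallReparam c) := by
  unfold wallReparam; fun_prop

omit [NeZero k] in
/-- `wallReparam` maps `[0, 1]` into `[0, 1]` when `c ∈ [0, 1]`. [folklore] -/
theorem wallReparam_mem {c : ℝ} (hc : c ∈ Icc (0 : ℝ) 1) {x : ℝ} (hx : x ∈ Icc (0 : ℝ) 1) :
    wallReparam c x ∈ Icc (0 : ℝ) 1 := by
  simp only [wallReparam, mem_Icc, le_min_iff, min_le_iff, le_max_iff, max_le_iff]
  refine ⟨⟨by linarith [hx.1], Or.inl hc.1⟩, ?_⟩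
  by_cases h : 2 * x ≤ 1
  · exact Or.inl h
  · exact Or.inr ⟨hc.2, by linarith [hx.2]⟩

/-- **Cutting along a wall.** If the compactly supported sphere `φ` is `x₀` on the hyperplane
`{y₀ = a}`, then its class is the product of the classes of its upper and lower pieces:
the concatenation `transAt 0 (lower) (upper)` of the stretched loops is the reparametrisation
`wallReparam` of `φ` in the coordinate `0`, homotopic rel `∂Iᵏ` to `φ` by straightening the
reparametrisation (Mathlib's `HomotopyGroup.mul_spec`: `⟦p⟧ * ⟦q⟧ = ⟦transAt i q p⟧`).
[folklore] -/
theorem toClass_eq_mul_of_wall (φ : CSphere k X x₀) (a : ℝ)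
    (hwall : ∀ y : Fin k → ℝ, y 0 = a → φ y = x₀) :
    φ.toClass = (upperPiece φ a hwall).toClass * (lowerPiece φ a hwall).toClass := by
  classical
  -- a common radius `R > |a|`
  obtain ⟨R₀, hR₀0, hR₀⟩ := φ.exists_bound_nonneg
  set R : ℝ := max R₀ (|a| + 1) with hRdef
  have hR0 : 0 ≤ R := hR₀0.trans (le_max_left _ _)
  have hRpos : 0 < R := lt_of_lt_of_le (by positivity) (le_max_right _ _)
  have haR : |a| < R := lt_of_lt_of_le (lt_add_one _) (le_max_right _ _)
  have hφR : ∀ y, R ≤ ‖y‖ → φ y = x₀ := fun y hy => hR₀ y ((le_max_left _ _).trans hy)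
  have hLR : ∀ y, R ≤ ‖y‖ → lowerPiece φ a hwall y = x₀ := fun y hy => by
    rw [lowerPiece_apply]; split_ifs; exacts [hφR y hy, rfl]
  have hUR : ∀ y, R ≤ ‖y‖ → upperPiece φ a hwall y = x₀ := fun y hy => by
    rw [upperPiece_apply]; split_ifs; exacts [hφR y hy, rfl]
  rw [φ.toClass_eq' hR0 hφR, (lowerPiece φ a hwall).toClass_eq' hR0 hLR,
    (upperPiece φ a hwall).toClass_eq' hR0 hUR]
  refine Eq.trans ?_ (HomotopyGroup.mul_spec (i := (0 : Fin k))).symm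
  -- the wall in cube coordinates
  set c : ℝ := (a + R) / (2 * R) with hcdef
  have hc01 : c ∈ Icc (0 : ℝ) 1 := by
    rw [abs_lt] at haR
    constructor
    · rw [hcdef, le_div_iff₀ (by positivity)]; linarith
    · rw [hcdef, div_le_iff₀ (by positivity)]; linarith
  -- names for the three generalized loops
  set f := toGenLoop φ R hR0 hφR with hf
  set fL := toGenLoop (lowerPiece φ a hwall) R hR0 hLR with hfL
  set fU := toGenLoop (upperPiece φ a hwall) R hR0 hUR with hfU
  -- the coordinate `0` after stretching an updated point
  have hst0 : ∀ (z : Fin k → I) (v : I), stretch R (Function.update z 0 v) 0 = 2 * R * (v : ℝ) - R := by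
    intro z v; simp [stretch]
  have hle_iff : ∀ v : I, 2 * R * (v : ℝ) - R ≤ a ↔ (v : ℝ) ≤ c := fun v => by
    rw [hcdef, le_div_iff₀ (by positivity)]; constructor <;> intro h <;> linarith
  have hge_iff : ∀ v : I, a ≤ 2 * R * (v : ℝ) - R ↔ c ≤ (v : ℝ) := fun v => by
    rw [hcdef, div_le_iff₀ (by positivity)]; constructor <;> intro h <;> linarith
  have hwall' : ∀ (z : Fin k → I) (v : I), (v : ℝ) = c → φ (stretch R (Function.update z 0 v)) = x₀ :=
    fun z v hv => hwall _ (by rw [hst0, hv, hcdef]; field_simp; ring)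
  -- unfolding `transAt`
  have hta : ∀ z : Fin k → I, GenLoop.transAt 0 fL fU z =
      if ((z 0 : I) : ℝ) ≤ 1 / 2 then fL (Function.update z 0 (projIcc 0 1 zero_le_one (2 * (z 0 : ℝ))))
      else fU (Function.update z 0 (projIcc 0 1 zero_le_one (2 * (z 0 : ℝ) - 1))) := fun z => rfl
  -- the pointwise identity: the concatenation is the `wallReparam`-reparametrisation of `f`
  have key : ∀ z : Fin k → I, GenLoop.transAt 0 fL fU z =
      f (Function.update z 0 (projIcc 0 1 zero_le_one (wallReparam c (z 0)))) := by
    intro z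
    set x : ℝ := (z 0 : ℝ) with hx
    have hx0 : 0 ≤ x := (z 0).2.1
    have hx1 : x ≤ 1 := (z 0).2.2
    rw [hta z]
    show (if x ≤ 1 / 2 then lowerPiece φ a hwall (stretch R _) else upperPiece φ a hwall (stretch R _)) =
      φ (stretch R _)
    split_ifs with hhalf
    · -- first half: lower piece at parameter `2x`
      have hp : (projIcc 0 1 zero_le_one (2 * x) : ℝ) = 2 * x := by
        rw [projIcc_of_mem _ ⟨by linarith, by linarith⟩]
      rw [lowerPiece_apply, hst0]
      by_cases hcx : 2 * x ≤ c
      · -- `2x ≤ c`: `wallReparam c x = 2x`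
        rw [if_pos ((hle_iff _).2 (by rw [hp]; exact hcx))]
        have hw : wallReparam c x = 2 * x := by
          unfold wallReparam; rw [min_eq_left]; exact le_trans hcx (le_max_left _ _)
        congr 3; apply Subtype.ext
        rw [hp, hw, projIcc_of_mem _ (show 2 * x ∈ Icc (0 : ℝ) 1 from ⟨by linarith, by linarith⟩)]
      · -- `c < 2x ≤ 1`: the concatenation pauses at the wall
        rw [if_neg fun h => hcx (by rw [← hp]; exact (hle_iff _).1 h)]
        have hw : wallReparam c x = c := by
          unfold wallReparam
          rw [max_eq_left (by linarith [hc01.1]), min_eq_right (not_le.1 hcx).le]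
        exact (hwall' z _ (by rw [hw, projIcc_of_mem _ hc01])).symm
    · -- second half: upper piece at parameter `2x - 1`
      have hp : (projIcc 0 1 zero_le_one (2 * x - 1) : ℝ) = 2 * x - 1 := by
        rw [projIcc_of_mem _ ⟨by linarith, by linarith⟩]
      rw [upperPiece_apply, hst0]
      by_cases hcx : c ≤ 2 * x - 1
      · rw [if_pos ((hge_iff _).2 (by rw [hp]; exact hcx))]
        have hw : wallReparam c x = 2 * x - 1 := by
          unfold wallReparam; rw [max_eq_right hcx, min_eq_right (by linarith)]
        congr 3; apply Subtype.ext
        rw [hp, hw, projIcc_of_mem _ (show 2 * x - 1 ∈ Icc (0 : ℝ) 1 from ⟨by linarith, by linarith⟩)]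
      · rw [if_neg fun h => hcx (by rw [← hp]; exact (hge_iff _).1 h)]
        have hw : wallReparam c x = c := by
          unfold wallReparam
          rw [max_eq_left (not_le.1 hcx).le, min_eq_right (by linarith [hc01.2])]
        exact (hwall' z _ (by rw [hw, projIcc_of_mem _ hc01])).symm
  -- the homotopy straightening the reparametrisation
  refine Quotient.sound (genLoop_homotopic_of_fun
    (fun p : I × (Fin k → I) => f (Function.update p.2 0 (projIcc 0 1 zero_le_one
      ((1 - (p.1 : ℝ)) * (p.2 0 : ℝ) + (p.1 : ℝ) * wallReparam c (p.2 0)))))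
    ?_ (fun z => ?_) (fun z => ?_) fun t z hz => ?_)
  · refine f.1.continuous.comp (Continuous.update continuous_snd _ (continuous_projIcc.comp ?_))
    have hc : Continuous fun p : I × (Fin k → I) => ((p.2 0 : I) : ℝ) :=
      continuous_subtype_val.comp ((continuous_apply 0).comp continuous_snd)
    exact ((continuous_const.sub (continuous_subtype_val.comp continuous_fst)).mul hc).add
      ((continuous_subtype_val.comp continuous_fst).mul ((continuous_wallReparam c).comp hc))
  · -- time `0`: the identity reparametrisation
    show f _ = f z
    congr 1
    rw [show (1 - ((0 : I) : ℝ)) * (z 0 : ℝ) + ((0 : I) : ℝ) * wallReparam c (z 0) = z 0 by simp,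
      projIcc_val zero_le_one (z 0), Function.update_eq_self]
  · -- time `1`: the `wallReparam`-reparametrisation, i.e. the concatenation
    rw [key z]
    congr 3
    simp
  · -- rel `∂Iᵏ`
    obtain ⟨j, hj⟩ := hz
    apply f.2
    dsimp only
    by_cases hj0 : j = 0
    · subst hj0
      refine ⟨0, ?_⟩
      rw [Function.update_self]
      rcases hj with hj | hj
      · left; apply Subtype.ext
        rw [hj]
        have h0 : wallReparam c 0 = 0 := by
          unfold wallReparam
          rw [mul_zero, zero_sub, max_eq_left (by linarith [hc01.1]), min_eq_left hc01.1]
        simp [h0]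
      · right; apply Subtype.ext
        rw [hj]
        have h1 : wallReparam c 1 = 1 := by
          unfold wallReparam
          rw [mul_one, max_eq_right (by linarith [hc01.2])]; norm_num
        simp [h1]
    · exact ⟨j, by rw [Function.update_of_ne hj0]; exact hj⟩

/-! ### Slabs -/

/-- The frontier of the closed slab `{c ≤ y₀ ≤ d}` lies in the two hyperplanes. [folklore] -/
theorem frontier_slab_subset (c d : ℝ) :
    frontier {y : Fin k → ℝ | c ≤ y 0 ∧ y 0 ≤ d} ⊆ {y | y 0 = c ∨ y 0 = d} := by
  intro y hy
  have h : {y : Fin k → ℝ | c ≤ y 0 ∧ y 0 ≤ d} = {y | c ≤ y 0} ∩ {y | y 0 ≤ d} := rfl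
  rw [h] at hy
  rcases (frontier_inter_subset _ _) hy with hy | hy
  · exact Or.inl (frontier_setOf_le_apply_subset c hy.1)
  · exact Or.inr (frontier_setOf_apply_le_subset d hy.2)

/-- **The piece on a closed slab** `{c ≤ y₀ ≤ d}` of a sphere vanishing on the two walls.
[folklore] -/
def slabPiece (φ : CSphere k X x₀) (c d : ℝ) (hc : ∀ y : Fin k → ℝ, y 0 = c → φ y = x₀)
    (hd : ∀ y : Fin k → ℝ, y 0 = d → φ y = x₀) : CSphere k X x₀ :=
  piece φ {y | c ≤ y 0 ∧ y 0 ≤ d} fun y hy => by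
    rcases frontier_slab_subset c d hy with h | h
    exacts [hc y h, hd y h]

/-- The slab piece, evaluated. [folklore] -/
theorem slabPiece_apply (φ : CSphere k X x₀) (c d : ℝ) (hc hd) (y : Fin k → ℝ) :
    slabPiece φ c d hc hd y = if c ≤ y 0 ∧ y 0 ≤ d then φ y else x₀ := by
  classical exact piece_apply φ _ _ y

/-- **Slab additivity.** Let `w₀ ≤ w₁ ≤ ⋯ ≤ wₘ` be walls such that the compactly supported sphere
`φ` is `x₀` on every hyperplane `{y₀ = wᵢ}`, below `w₀` and above `wₘ`. Then the class of `φ`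
is the product of the classes of its pieces on the slabs `{wᵢ ≤ y₀ ≤ wᵢ₊₁}` (`k ≥ 2`, so that
`πₖ` is commutative; induction on `m`, cutting off the last slab with
`toClass_eq_mul_of_wall`). [folklore] -/
theorem toClass_eq_prod_slabPiece [Nontrivial (Fin k)] (m : ℕ) :
    ∀ (φ : CSphere k X x₀) (w : Fin (m + 1) → ℝ), Monotone w →
      ∀ (hw : ∀ i, ∀ y : Fin k → ℝ, y 0 = w i → φ y = x₀),
      (∀ y : Fin k → ℝ, y 0 ≤ w 0 → φ y = x₀) → (∀ y : Fin k → ℝ, w (Fin.last m) ≤ y 0 → φ y = x₀) →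
        φ.toClass = ∏ i : Fin m, (slabPiece φ (w i.castSucc) (w i.succ) (hw _) (hw _)).toClass := by
  induction m with
  | zero =>
    intro φ w _ hw hlo hhi
    rw [Finset.univ_eq_empty, Finset.prod_empty]
    have : φ = const := ext fun y => by
      rcases le_total (y 0) (w 0) with h | h
      · exact hlo y h
      · exact hhi y h
    rw [this, toClass_const]
  | succ m ih =>
    intro φ w hmono hw hlo hhi
    -- cut at the last-but-one wall `a = w m`
    set a : ℝ := w (Fin.last m).castSucc with ha
    have hwa : ∀ y : Fin k → ℝ, y 0 = a → φ y = x₀ := hw _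
    rw [toClass_eq_mul_of_wall φ a hwa, Fin.prod_univ_castSucc, mul_comm]
    congr 1
    · -- the lower piece: induction hypothesis with the first `m + 1` walls
      set L := lowerPiece φ a hwa with hL
      have hL' : ∀ y, L y = if y 0 ≤ a then φ y else x₀ := lowerPiece_apply φ a hwa
      have hwL : ∀ i : Fin (m + 1), ∀ y : Fin k → ℝ, y 0 = w i.castSucc → L y = x₀ := by
        intro i y hy; rw [hL']; split_ifs; exacts [hw _ y hy, rfl]
      have hloL : ∀ y : Fin k → ℝ, y 0 ≤ w (0 : Fin (m + 1)).castSucc → L y = x₀ := by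
        intro y hy; rw [hL']; split_ifs; exacts [hlo y hy, rfl]
      have hhiL : ∀ y : Fin k → ℝ, w (Fin.last m).castSucc ≤ y 0 → L y = x₀ := by
        intro y hy; rw [hL']
        split_ifs with h
        · exact hwa y (le_antisymm h hy)
        · rfl
      rw [ih L (fun i => w i.castSucc) (fun i j hij => hmono (by exact hij)) hwL hloL hhiL]
      refine Finset.prod_congr rfl fun i _ => ?_
      congr 1
      refine ext fun y => ?_
      rw [slabPiece_apply, slabPiece_apply, Fin.succ_castSucc]
      split_ifs with h
      · rw [hL', if_pos]
        exact h.2.trans (hmono (Fin.le_def.2 (by simp)))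
      · rfl
    · -- the upper piece is the piece on the last slab
      congr 1
      refine ext fun y => ?_
      rw [upperPiece_apply, slabPiece_apply]
      by_cases h1 : a ≤ y 0
      · rw [if_pos h1]
        by_cases h2 : y 0 ≤ w (Fin.last m).succ
        · rw [if_pos ⟨h1, h2⟩]
        · rw [if_neg (fun h => h2 h.2)]
          exact hhi y (by rw [← Fin.succ_last]; exact (not_le.1 h2).le)
      · rw [if_neg h1, if_neg (fun h => h1 h.1)]


end Wall

end CSphere

end Literature.AlgebraicTopology.Homotopy

end
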